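import Mathlib
import Summits.CriticalPhenomena.CardyFormulaZ2.Theorems.CardySelfRefinementGradientComparabilityStubBulkPivotalSumDivergesAssembly
import Summits.CriticalPhenomena.CardyFormulaZ2.Theorems.CardySelfRefinementGradientComparabilityStubBulkPivotalSumDivergesCondVariance
import HarnessLib

/-!
# (D3-bulk) The BULK pivotal count of a quad family diverges (bond-`ℤ²` at `p = ½`)

Crux `stmt-CriticalPhenomena-10269`
(`Summit.CriticalPhenomena.CardyFormulaZ2.Theses.CardySelfRefinement.GradientComparability`),
line **Sketch**, stub `stub_bulkPivotalSum_diverges`.  Vocabulary (`Aloc`, `window`) from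
`CardySelfRefinementDefs`.

**Theorem.**  For critical bond percolation on `ℤ²` drawn at mesh `η` and every nonempty finite
family `F` of quads there is `r > 0` such that the expected number of window edges at drawn
distance `≥ r` from all the sides of all the quads which are pivotal for the localised joint
crossing event `Aloc m F η` tends to `+∞` as `η → 0⁺`.

*Proof.*  Talagrand–Rossignol for the SECTIONS of `Aloc` given the boundary layer of edges, at
many cut radii (`bulkPivotalSum_diverges_of_condVariance`: one-cut inequality `percut_mean`,
smallness of the section influences of bulk edges by one open arm inside the bulk
`section_pivotal_uniformly_small`, telescoping over the cuts), fed with the non-degeneracy of the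
joint crossing event given the layer (`condVariance_given_layer`: open tubes along arcs routed
around a leaf of the closed dual tube, disjoint layer supports, decoupling
`condVariance_ge_of_disjoint_supports`).  (Talagrand 1994, Thm 1.1; Rossignol 2006, Thm 2.1;
Garban–Pete–Schramm 2010, §1.)
-/

noncomputable section

namespace Summit.CriticalPhenomena.CardyFormulaZ2.Theorems.CardySelfRefinement

open scoped Topology
open Filter Set MeasureTheory
open Literature.Probability.LatticeModels Literature.Probability.Percolation
open Literature.Probability.Percolation.QuadCrossing
open Summit.CriticalPhenomena.CardyFormulaZ2.Theses.CardySelfRefinement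

/-- **(D3-bulk) The bulk pivotal count diverges.**  For a nonempty finite quad family there is
`r > 0` such that `Σ_{e bulk} P_{1/2}(e pivotal for Aloc m F η) → ∞` as `η → 0⁺`, the bulk being
the window edges at drawn distance `≥ r` from all sides of all quads (Talagrand–Rossignol for the
sections of `Aloc` given the boundary layer ⨉ non-degeneracy given the layer). -/
theorem stub_bulkPivotalSum_diverges :
    ∀ (m : ℕ) (F : Fin m → Quad (Set.univ : Set ℂ)), 0 < m → ∃ r : ℝ, 0 < r ∧ ∀ N : ℝ,
      ∃ η₁ : ℝ, 0 < η₁ ∧ ∀ η ∈ Set.Ioo 0 η₁, ∀ Wb : Finset (Sym2 (Site 2)),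
        (↑Wb : Set (Sym2 (Site 2))) = {e ∈ window m F η | ∀ x ∈ e, ∀ (i : Fin m) (j : Fin 4),
            ∀ p ∈ (F i).side j, r ≤ dist ((η : ℂ) * squareLatticeEmbedding.z x) p} →
        N ≤ ∑ e ∈ Wb, (bondPercolation (zdGraph 2) half).real {ω | IsPivotal (Aloc m F η) e ω} := by
  intro m F hm
  obtain ⟨v₀, rC, ηC, hv₀, hrC, hηC, hC⟩ := condVariance_given_layer m F hm
  exact ⟨rC / 2, by positivity, bulkPivotalSum_diverges_of_condVariance m F hm hv₀ hrC hηC hC⟩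

end Summit.CriticalPhenomena.CardyFormulaZ2.Theorems.CardySelfRefinement

end
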